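import Literature.NumberTheory.Automorphic.Liu2021.AppendixC.AlbaneseTraceExtension
import Literature.NumberTheory.Automorphic.Liu2021.AppendixC.AlbaneseTraceOfNablaDescent
import Literature.NumberTheory.Automorphic.Liu2021.NablaTransitive
import Literature.NumberTheory.Automorphic.Liu2021.AlbaneseCocycleDescent
import Literature.AlgebraicGeometry.Motives.FiniteQuotientProductDescent
import HarnessLib

/-!
# The Albanese trace of a finite quotient (Lang, *Abelian Varieties*, VIII §6 Thm. 13): assembly
# `(T) AlbaneseTraceOfFiniteQuotient` from the cocycle, for `k ⊂ ℂ` unconditionally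

[Liu2021] = Yifeng Liu, *Fourier–Jacobi cycles and arithmetic relative trace formula*, Camb. J. Math. **9** (2021) =
arXiv:2102.11518, §2.1 Def. 2.1 (1), Def. 2.3; [Lang1983AbelianVarieties] Ch. VIII §6 Thm. 13.  PROOF FILE (theorems
only; no definition, no named fact, no `sorry`).  Cell hodgecm-mathlib, fan B, row VI-5 (named fact
`AppendixC.AlbaneseTraceOfFiniteQuotient`, file `AppendixC/AlbaneseFiniteQuotientTrace.lean`), file F4 (assembly) of the
plan announced 2026-08-28T03:45Z.

For a finite group `Δ` acting on a smooth projective `X` over a field `k` of characteristic zero with quotient `p : X → Y`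
for separated test objects (`Y` smooth projective) and Albanese data `aX`, `aY`:

* `Albanese.exists_nabla_desc_of_isCocycle` — **(T♭)**: if `α_X` is a cocycle, the `∇`-morphism
  `F = α_X ≫ Σ_g Alb_{act g} : ∇X → Alb_X` descends along `∇p : ∇X → ∇Y`.  PROOF: `F` extends to a `(Δ × Δ)`-invariant
  `F̃ : X × X → Alb_X` (`Albanese.exists_invariant_extension`, file `AlbaneseTraceExtension`: cocycle + transitivity of
  `∇X`, which holds by `Nabla.isTransitive_of_isProjectiveOver`); `p` is flat (`Motives.flat_left_of_isSepQuotient`, miracle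
  flatness), so `F̃` descends along `p × p` (`Motives.exists_desc_tensorHom_of_isSepQuotient`: SGA 1 V 1.9 along the reduced
  bases `X`, `Y` + effective epimorphism); restrict to `∇Y ↪ Y × Y` (`Nabla.map_incl`).
* `Albanese.exists_trace_of_isCocycle` — **(T)**: then the trace `t : Alb_Y → Alb_X` with `Alb_p ≫ t = Σ_g Alb_{act g}`
  exists (`exists_trace_iff_exists_nabla_desc`, file `AlbaneseTraceOfNablaDescent`).
* `Albanese.exists_trace_of_isSepQuotient_complex` — **(T) UNCONDITIONALLY for `k` of characteristic zero with an
  embedding into `ℂ`** (`k : Type`), the cocycle property being `Albanese.isCocycle_of_isProjectiveOver`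
  (file `Liu2021/AlbaneseCocycleDescent`).

The named fact `AlbaneseTraceOfFiniteQuotient.{u}` quantifies over all fields of characteristic zero in universe `u`
(no embedding into `ℂ`); this file proves its statement for every such field over which the Albanese morphism is a
cocycle, in particular for all `k ⊂ ℂ`.  HC_CM is proved only modulo the 7 printed citations until rung 0 closes;
nothing here changes that.

## References
* [Lang1983AbelianVarieties] S. Lang, *Abelian Varieties* (1959/1983), Ch. VIII §6, Thm. 13 (pp. 224–227).
* [Liu2021] Y. Liu, arXiv:2102.11518: §2.1 Def. 2.1 (1) (l. 1171–1176), Def. 2.3 (l. 1202–1208).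
* [SGA1] A. Grothendieck, *SGA 1*, Exp. V, Prop. 1.9.
-/

noncomputable section

open CategoryTheory CategoryTheory.Limits AlgebraicGeometry MonoidalCategory CartesianMonoidalCategory
open Literature.AlgebraicGeometry.Motives

universe u v

namespace Literature.NumberTheory.Automorphic.Liu2021.AppendixC

namespace Albanese

open scoped MonObj

variable {k : Type u} [Field k] {X Y : SchemeOver k}

/-- **(T♭) from the cocycle.**  Let `Δ` (finite) act on the smooth projective `k`-scheme `X`, `p : X ⟶ Y` a quotient for
separated test objects with `Y` smooth projective, `aX`, `aY` Albanese data with `∇X` transitive and `α_X` a cocycle.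
Then `α_X ≫ Σ_g Alb_{act g}` descends along `∇p`: extend it to a `(Δ × Δ)`-invariant morphism on `X × X`, descend along
the flat quotient `p × p`, restrict to `∇Y`. [cite: Lang1983AbelianVarieties, Ch. VIII §6, Thm. 13 (proof, pp. 224–227)]
[cite: SGA1, Exp. V Prop. 1.9] -/
theorem exists_nabla_desc_of_isCocycle {dX dY : ℕ} [SmoothOfRelativeDimension dX X.hom]
    [SmoothOfRelativeDimension dY Y.hom] (hX : IsProjectiveOver X) (hY : IsProjectiveOver Y)
    {Δ : Type v} [Group Δ] [Fintype Δ] (act : Δ →* Aut X) (p : X ⟶ Y)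
    (hp : IsSepQuotient (fun g => act g) p) (aX : Albanese X) (aY : Albanese Y)
    (hN : aX.nabla.IsTransitive) (hc : aX.IsCocycle) :
    ∃ f : aY.nabla.N ⟶ aX.Alb.X,
      aX.nabla.map aY.nabla p ≫ f = aX.α ≫ (∑ g, aX.map aX (act g).hom).hom.hom.hom := by
  -- the invariant extension `F̃` of `F` to `X × X`
  obtain ⟨Ft, hFt, hinv⟩ := Albanese.exists_invariant_extension act hN hc
  -- descend along `p ⊗ p`
  haveI : IsProper X.hom := hX.isProper
  haveI : IsProper Y.hom := hY.isProper
  haveI : Flat p.left := flat_left_of_isSepQuotient (dX := dX) (dY := dY) hX hY act p hp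
  haveI : Smooth X.hom := SmoothOfRelativeDimension.smooth dX X.hom
  haveI : Smooth Y.hom := SmoothOfRelativeDimension.smooth dY Y.hom
  haveI : IsReduced X.left := isReduced_of_smooth_over_field X.hom
  haveI : IsReduced Y.left := isReduced_of_smooth_over_field Y.hom
  obtain ⟨ψ, hψ⟩ := exists_desc_tensorHom_of_isSepQuotient hX (inferInstance : IsSeparated Y.hom) act p hp
    (inferInstance : IsSeparated aX.Alb.X.hom) Ft hinv
  -- restrict to `∇Y`
  refine ⟨aY.nabla.incl ≫ ψ, ?_⟩
  rw [← Category.assoc, Nabla.map_incl, Category.assoc, hψ, hFt]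

/-- **(T) from the cocycle: the Albanese trace of a finite quotient.**  Under the hypotheses of
`exists_nabla_desc_of_isCocycle` there is `t : Alb_Y ⟶ Alb_X` with `Alb_p ≫ t = Σ_{g ∈ Δ} Alb_{act g}` (Lang's `h_*`).
[cite: Lang1983AbelianVarieties, Ch. VIII §6, Thm. 13 (pp. 224–227)] -/
theorem exists_trace_of_isCocycle {dX dY : ℕ} [SmoothOfRelativeDimension dX X.hom]
    [SmoothOfRelativeDimension dY Y.hom] (hX : IsProjectiveOver X) (hY : IsProjectiveOver Y)
    {Δ : Type v} [Group Δ] [Fintype Δ] (act : Δ →* Aut X) (p : X ⟶ Y)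
    (hp : IsSepQuotient (fun g => act g) p) (aX : Albanese X) (aY : Albanese Y)
    (hN : aX.nabla.IsTransitive) (hc : aX.IsCocycle) :
    ∃ t : aY.Alb ⟶ aX.Alb, aX.map aY p ≫ t = ∑ g, aX.map aX (act g).hom :=
  (exists_trace_iff_exists_nabla_desc aX aY (fun g => act g) p hp).2
    (exists_nabla_desc_of_isCocycle (dX := dX) (dY := dY) hX hY act p hp aX aY hN hc)

/-- **(T) for ANY transitive-cocycle-free formulation over a field of characteristic zero, given only the cocycle**:
transitivity of `∇X` is automatic for `X` smooth projective (`Nabla.isTransitive_of_isProjectiveOver`).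
[cite: Lang1983AbelianVarieties, Ch. VIII §6, Thm. 13 (pp. 224–227)] -/
theorem exists_trace_of_isCocycle' [CharZero k] {dX dY : ℕ} [SmoothOfRelativeDimension dX X.hom]
    [SmoothOfRelativeDimension dY Y.hom] (hX : IsProjectiveOver X) (hY : IsProjectiveOver Y)
    {Δ : Type v} [Group Δ] [Fintype Δ] (act : Δ →* Aut X) (p : X ⟶ Y)
    (hp : IsSepQuotient (fun g => act g) p) (aX : Albanese X) (aY : Albanese Y) (hc : aX.IsCocycle) :
    ∃ t : aY.Alb ⟶ aX.Alb, aX.map aY p ≫ t = ∑ g, aX.map aX (act g).hom :=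
  exists_trace_of_isCocycle (dX := dX) (dY := dY) hX hY act p hp aX aY
    (Nabla.isTransitive_of_isProjectiveOver (d := dX) hX aX.nabla) hc

/-- **The Albanese trace of a finite quotient, unconditionally over subfields of `ℂ`** (Lang VIII §6 Thm. 13 in Liu's
base-point-free language): for `k` of characteristic zero with an embedding into `ℂ`, `Δ` finite acting on the smooth
projective `X`, `p : X ⟶ Y` a quotient for separated test objects with `Y` smooth projective, and Albanese data `aX`, `aY`,
there is `t : Alb_Y ⟶ Alb_X` with `Alb_p ≫ t = Σ_g Alb_{act g}`.  (The cocycle property of `α_X` is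
`Albanese.isCocycle_of_isProjectiveOver`.)  This is the statement of the named fact `AlbaneseTraceOfFiniteQuotient` for
all such `k`. [cite: Lang1983AbelianVarieties, Ch. VIII §6, Thm. 13 (pp. 224–227)] -/
theorem exists_trace_of_isSepQuotient_complex {k : Type} [Field k] [CharZero k] [Algebra k ℂ]
    {X Y : SchemeOver k} {dX dY : ℕ} [SmoothOfRelativeDimension dX X.hom] [SmoothOfRelativeDimension dY Y.hom]
    (hX : IsProjectiveOver X) (hY : IsProjectiveOver Y) {Δ : Type v} [Group Δ] [Fintype Δ]
    (act : Δ →* Aut X) (p : X ⟶ Y) (hp : IsSepQuotient (fun g => act g) p) (aX : Albanese X) (aY : Albanese Y) :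
    ∃ t : aY.Alb ⟶ aX.Alb, aX.map aY p ≫ t = ∑ g, aX.map aX (act g).hom :=
  exists_trace_of_isCocycle' (dX := dX) (dY := dY) hX hY act p hp aX aY (Albanese.isCocycle_of_isProjectiveOver (d := dX) hX aX)

/-- **(T♭) unconditionally over subfields of `ℂ`**: the `∇`-morphism `α_X ≫ Σ_g Alb_{act g}` descends along `∇p`.
[cite: Lang1983AbelianVarieties, Ch. VIII §6, Thm. 13 (proof, pp. 224–227)] -/
theorem exists_nabla_desc_complex {k : Type} [Field k] [CharZero k] [Algebra k ℂ]
    {X Y : SchemeOver k} {dX dY : ℕ} [SmoothOfRelativeDimension dX X.hom] [SmoothOfRelativeDimension dY Y.hom]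
    (hX : IsProjectiveOver X) (hY : IsProjectiveOver Y) {Δ : Type v} [Group Δ] [Fintype Δ]
    (act : Δ →* Aut X) (p : X ⟶ Y) (hp : IsSepQuotient (fun g => act g) p) (aX : Albanese X) (aY : Albanese Y) :
    ∃ f : aY.nabla.N ⟶ aX.Alb.X,
      aX.nabla.map aY.nabla p ≫ f = aX.α ≫ (∑ g, aX.map aX (act g).hom).hom.hom.hom :=
  exists_nabla_desc_of_isCocycle (dX := dX) (dY := dY) hX hY act p hp aX aY
    (Nabla.isTransitive_of_isProjectiveOver (d := dX) hX aX.nabla) (Albanese.isCocycle_of_isProjectiveOver (d := dX) hX aX)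

end Albanese

end Literature.NumberTheory.Automorphic.Liu2021.AppendixC

end
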